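import Summits.ValiantsHypothesis.ValiantsHypothesis.Theorems.SymPencilPerFourToricZeroRow

/-!
# Route `SymPencil` — the toric case at dimension `6`, IV: single-row spaces and the profile
# `(2,2,1,1)` (`--supports` stmt-ValiantsHypothesis-5674 `SdcSuperquadratic`; crux workfile
# `Cruxes/SdcSuperquadratic/TORIC-SIX.md`)

Setting: `W` a `6`-dimensional space of `4 × 4` matrices with H3 and all row and column ranks
`≤ 2`.

* `single_row_realize` — if the elements of `W` vanishing on the three rows `≠ p` have dimension
  `≥ n_p = rank of row p`, then they realise every row-`p` value of `W` (row `p` SPLITS OFF as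
  independent single-row elements).
* `false_of_two_rows_rank_le_one` — **no toric `6`-dimensional singular subspace has two rows of
  rank `≤ 1`.**  Otherwise (zero rows being excluded by `SymPencilPerFourToricZeroRow`) the
  profile is `(2,2,1,1)`, all four rows split off (`W = L_p ⊕ L_{p'} ⊕ K v_q ⊕ K v_{q'}`), the
  pair lever on the rows `(p, q)` has kernel `⊇ L_{p'} + K v_{q'}`, which must have dimension `2`
  (else `L_p ⊥ v_q` entirely, impossible for `dim L_p = 2`), so `v_{q'} ∈ L_{p'}`; symmetrically
  `v_q ∈ L_p ∩ L_{p'}`, and a column in the support of `v_q` has rank `3`.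

Honest framing: one profile of the toric case of `R6`; nothing here changes `sdc(per_4) ≥ 25`; the
crux `SdcSuperquadratic` and `VP ≠ VNP` are untouched.  No definitions, no named facts. [folklore]
-/

noncomputable section

-- single-conjunct layout: Sub = Summit, duplicated namespace component intended
set_option linter.dupNamespace false

namespace Summit.ValiantsHypothesis.ValiantsHypothesis.Theorems.SymPencilPerFourToricLowRank

open Matrix Finset Module
open Literature.Computability.AlgebraicComplexity
open Literature.Computability.AlgebraicComplexity.AlperBogartVelasco
open Summit.ValiantsHypothesis.ValiantsHypothesis.Theorems.SymPencilPerFourHessianRankThreeZero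
open Summit.ValiantsHypothesis.ValiantsHypothesis.Theorems.SymPencilPerFourHessianToric
open Summit.ValiantsHypothesis.ValiantsHypothesis.Theorems.SymPencilPerFourToricLever
open Summit.ValiantsHypothesis.ValiantsHypothesis.Theorems.SymPencilPerFourToricZeroRow

variable {K : Type*} [Field K]

/-- **Single-row elements realise a row.**  See the module docstring. [folklore] -/
theorem single_row_realize (W : Submodule K (Fin 4 × Fin 4 → K)) (p a b c : Fin 4)
    (hpa : p ≠ a) (hpb : p ≠ b) (hpc : p ≠ c) (hab : a ≠ b) (hac : a ≠ c) (hbc : b ≠ c)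
    (hT : finrank K (W.map (LinearMap.funLeft K K fun j : Fin 4 => (p, j))) ≤
      finrank K ↥(W ⊓ LinearMap.ker (LinearMap.funLeft K K fun j : Fin 4 => (a, j)) ⊓
        LinearMap.ker (LinearMap.funLeft K K fun j : Fin 4 => (b, j)) ⊓
        LinearMap.ker (LinearMap.funLeft K K fun j : Fin 4 => (c, j)))) :
    finrank K ↥(W ⊓ LinearMap.ker (LinearMap.funLeft K K fun j : Fin 4 => (a, j)) ⊓
        LinearMap.ker (LinearMap.funLeft K K fun j : Fin 4 => (b, j)) ⊓
        LinearMap.ker (LinearMap.funLeft K K fun j : Fin 4 => (c, j))) =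
      finrank K (W.map (LinearMap.funLeft K K fun j : Fin 4 => (p, j))) ∧
    ∀ x ∈ W, ∃ z ∈ W, (∀ i j, i ≠ p → z (i, j) = 0) ∧ ∀ j, z (p, j) = x (p, j) := by
  classical
  let ρ : Fin 4 → (Fin 4 × Fin 4 → K) →ₗ[K] (Fin 4 → K) :=
    fun r => LinearMap.funLeft K K fun j : Fin 4 => (r, j)
  have hρ : ∀ r x j, ρ r x j = x (r, j) := fun _ _ _ => rfl
  set T := W ⊓ LinearMap.ker (ρ a) ⊓ LinearMap.ker (ρ b) ⊓ LinearMap.ker (ρ c) with hTdef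
  change finrank K (W.map (ρ p)) ≤ finrank K T at hT
  change finrank K T = finrank K (W.map (ρ p)) ∧ _
  have memT : ∀ z, z ∈ T ↔ z ∈ W ∧ (∀ j, z (a, j) = 0) ∧ (∀ j, z (b, j) = 0) ∧
      ∀ j, z (c, j) = 0 := by
    intro z
    rw [hTdef, Submodule.mem_inf, mem_pair_iff, LinearMap.mem_ker]
    exact ⟨fun h => ⟨h.1.1, h.1.2.1, h.1.2.2, fun j => congr_fun h.2 j⟩,
      fun h => ⟨⟨h.1, h.2.1, h.2.2.1⟩, funext h.2.2.2⟩⟩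
  have hsingle : ∀ z ∈ T, ∀ i j, i ≠ p → z (i, j) = 0 := by
    intro z hz i j hip
    obtain ⟨-, hza, hzb, hzc⟩ := (memT z).1 hz
    rcases eq_or_of_four p a b c hpa hpb hpc hab hac hbc i with hi | hi | hi | hi
    · exact absurd hi hip
    · rw [hi]; exact hza j
    · rw [hi]; exact hzb j
    · rw [hi]; exact hzc j
  have hinj : Function.Injective ((ρ p).domRestrict T) := by
    intro z₁ z₂ h
    apply Subtype.ext
    funext q; obtain ⟨i, j⟩ := q
    have hsub : ((z₁ : Fin 4 × Fin 4 → K) - z₂) ∈ T := T.sub_mem z₁.2 z₂.2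
    by_cases hip : i = p
    · have := congr_fun h j
      simp only [LinearMap.domRestrict_apply, hρ] at this
      rw [hip]; exact this
    · exact sub_eq_zero.1 (by have := hsingle _ hsub i j hip; rwa [Pi.sub_apply] at this)
  have hTmap : finrank K (T.map (ρ p)) = finrank K T := by
    rw [← LinearMap.range_domRestrict]; exact LinearMap.finrank_range_of_inj hinj
  have hTW : T ≤ W := inf_le_left.trans (inf_le_left.trans inf_le_left)
  have hle : T.map (ρ p) ≤ W.map (ρ p) := Submodule.map_mono hTW
  have heq : T.map (ρ p) = W.map (ρ p) :=
    Submodule.eq_of_le_of_finrank_le hle (by rw [hTmap]; exact hT)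
  refine ⟨?_, fun x hx => ?_⟩
  · rw [← hTmap, heq]
  · have : ρ p x ∈ T.map (ρ p) := by rw [heq]; exact ⟨x, hx, rfl⟩
    obtain ⟨z, hzT, hzx⟩ := this
    exact ⟨z, hTW hzT, hsingle z hzT, fun j => by have := congr_fun hzx j; rwa [hρ] at this⟩

set_option maxHeartbeats 800000 in
/-- **Key step of the profile `(2,2,1,1)`.**  Rows `s, t` split off as single-row elements,
`n_s = 2`, `0 < n_t ≤ 1`, `n_{t'} ≤ 1`: then every row-`t'` value of `W` lies in the row-`s'`
image (else the pair lever on rows `(s, t)` has a `3`-dimensional kernel and `L_s ⊥ v_t`).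
[folklore] -/
theorem row_mem_of_split [CharZero K] (W : Submodule K (Fin 4 × Fin 4 → K))
    (hW3 : ∀ x ∈ W, ∀ (r c : Fin 3 → Fin 4), Function.Injective r → Function.Injective c →
      ((Matrix.of fun i j => x (i, j)).submatrix r c).permanent = 0)
    (hrow : ∀ r : Fin 4, finrank K (W.map (LinearMap.funLeft K K fun j : Fin 4 => (r, j))) ≤ 2)
    (h6 : finrank K W = 6) (s s' t t' : Fin 4) (hss' : s ≠ s') (hst : s ≠ t) (hst' : s ≠ t')
    (hs't : s' ≠ t) (hs'tt : s' ≠ t') (htt' : t ≠ t')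
    (hs2 : finrank K (W.map (LinearMap.funLeft K K fun j : Fin 4 => (s, j))) = 2)
    (ht0 : finrank K (W.map (LinearMap.funLeft K K fun j : Fin 4 => (t, j))) ≠ 0)
    (ht1 : finrank K (W.map (LinearMap.funLeft K K fun j : Fin 4 => (t, j))) ≤ 1)
    (ht'1 : finrank K (W.map (LinearMap.funLeft K K fun j : Fin 4 => (t', j))) ≤ 1)
    (Ss : ∀ x ∈ W, ∃ z ∈ W, (∀ i j, i ≠ s → z (i, j) = 0) ∧ ∀ j, z (s, j) = x (s, j))
    (St : ∀ x ∈ W, ∃ z ∈ W, (∀ i j, i ≠ t → z (i, j) = 0) ∧ ∀ j, z (t, j) = x (t, j)) :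
    ∀ y ∈ W, (LinearMap.funLeft K K fun j : Fin 4 => (t', j)) y ∈
      W.map (LinearMap.funLeft K K fun j : Fin 4 => (s', j)) := by
  classical
  intro y hy
  set ρs := (LinearMap.funLeft K K fun j : Fin 4 => (s, j)) with hρs
  set ρs' := (LinearMap.funLeft K K fun j : Fin 4 => (s', j)) with hρs'
  set ρt := (LinearMap.funLeft K K fun j : Fin 4 => (t, j)) with hρt
  set ρt' := (LinearMap.funLeft K K fun j : Fin 4 => (t', j)) with hρt'
  have eρs : ∀ (x : Fin 4 × Fin 4 → K) (j : Fin 4), ρs x j = x (s, j) := fun _ _ => rfl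
  have eρs' : ∀ (x : Fin 4 × Fin 4 → K) (j : Fin 4), ρs' x j = x (s', j) := fun _ _ => rfl
  have eρt : ∀ (x : Fin 4 × Fin 4 → K) (j : Fin 4), ρt x j = x (t, j) := fun _ _ => rfl
  have eρt' : ∀ (x : Fin 4 × Fin 4 → K) (j : Fin 4), ρt' x j = x (t', j) := fun _ _ => rfl
  have hrs : finrank K (W.map ρs) ≤ 2 := hrow s
  have hrs' : finrank K (W.map ρs') ≤ 2 := hrow s'
  by_contra hnot
  -- `M = L_{s'} + K v` has dimension `≥ 3`
  set M : Submodule K (Fin 4 → K) := W.map ρs' ⊔ K ∙ (ρt' y) with hM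
  have hv0 : ρt' y ≠ 0 := fun h => hnot (by rw [h]; exact Submodule.zero_mem _)
  -- `n_{s'} = 2`
  have hs'2 : finrank K (W.map ρs') = 2 := by
    have d : finrank K W ≤ finrank K ↥(W ⊓ LinearMap.ker ρt ⊓ LinearMap.ker ρt') +
        finrank K (W.map ρt) + finrank K (W.map ρt') := finrank_pair_le W t t'
    set P := W ⊓ LinearMap.ker ρt ⊓ LinearMap.ker ρt' with hP
    have d1 := finrank_eq_finrank_map_add_finrank_inf_ker P ρs
    have m1 : finrank K (P.map ρs) ≤ 2 :=
      (Submodule.finrank_mono (Submodule.map_mono (inf_le_left.trans inf_le_left))).trans hrs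
    have hinj : Function.Injective (ρs'.domRestrict (P ⊓ LinearMap.ker ρs)) := by
      intro z₁ z₂ hz
      apply Subtype.ext
      have hsub := (P ⊓ LinearMap.ker ρs).sub_mem z₁.2 z₂.2
      simp only [hP, Submodule.mem_inf, LinearMap.mem_ker] at hsub
      obtain ⟨⟨⟨-, hzt⟩, hzt'⟩, hzs⟩ := hsub
      funext c; obtain ⟨i, j⟩ := c
      refine sub_eq_zero.1 ?_
      rw [← Pi.sub_apply]
      rcases eq_or_of_four s s' t t' hss' hst hst' hs't hs'tt htt' i with hi | hi | hi | hi
      · rw [hi]; have := congr_fun hzs j; rwa [eρs] at this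
      · rw [hi]; have := congr_fun hz j
        simp only [LinearMap.domRestrict_apply] at this
        rw [eρs', eρs'] at this
        rw [Pi.sub_apply, this, sub_self]
      · rw [hi]; have := congr_fun hzt j; rwa [eρt] at this
      · rw [hi]; have := congr_fun hzt' j; rwa [eρt'] at this
    have m2 : finrank K ↥(P ⊓ LinearMap.ker ρs) ≤ finrank K (W.map ρs') := by
      have := LinearMap.finrank_range_of_inj hinj
      rw [LinearMap.range_domRestrict] at this
      rw [← this]
      exact Submodule.finrank_mono (Submodule.map_mono
        (inf_le_left.trans (inf_le_left.trans inf_le_left)))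
    omega
  have hM3 : 3 ≤ finrank K M := by
    have hinf : W.map ρs' ⊓ (K ∙ ρt' y) = ⊥ := by
      rw [Submodule.eq_bot_iff]
      intro v hv
      obtain ⟨hv1, hv2⟩ := Submodule.mem_inf.1 hv
      rw [Submodule.mem_span_singleton] at hv2
      obtain ⟨c, rfl⟩ := hv2
      by_cases hc : c = 0
      · rw [hc, zero_smul]
      · exfalso; apply hnot
        have := Submodule.smul_mem (W.map ρs') c⁻¹ hv1
        rwa [smul_smul, inv_mul_cancel₀ hc, one_smul] at this
    have h := Submodule.finrank_sup_add_finrank_inf_eq (W.map ρs') (K ∙ ρt' y)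
    rw [hinf, finrank_bot, add_zero, finrank_span_singleton hv0] at h
    rw [hM]; omega
  -- the lever identity on `M` for elements with rows `s', t'` zero
  have hlev : ∀ x ∈ W, (∀ j, x (s', j) = 0) → (∀ j, x (t', j) = 0) →
      ∀ u ∈ M, ∀ j₀ j₁ j₂ : Fin 4, j₀ ≠ j₁ → j₀ ≠ j₂ → j₁ ≠ j₂ →
      u j₀ * (x (s, j₁) * x (t, j₂) + x (s, j₂) * x (t, j₁)) +
        u j₁ * (x (s, j₀) * x (t, j₂) + x (s, j₂) * x (t, j₀)) +
        u j₂ * (x (s, j₀) * x (t, j₁) + x (s, j₁) * x (t, j₀)) = 0 := by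
    intro x hx hxs' hxt' u hu j₀ j₁ j₂ h01 h02 h12
    rw [hM, Submodule.mem_sup] at hu
    obtain ⟨u₁, hu₁, u₂, hu₂, rfl⟩ := hu
    obtain ⟨y₁, hy₁, rfl⟩ := hu₁
    rw [Submodule.mem_span_singleton] at hu₂
    obtain ⟨c, rfl⟩ := hu₂
    have e1 := pair_lever W hW3 hx hy₁ hst hss' hs't.symm hxs' h01 h02 h12
    have e2 := pair_lever W hW3 hx hy hst hst' htt' hxt' h01 h02 h12
    simp only [Pi.add_apply, Pi.smul_apply, smul_eq_mul, eρs', eρt']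
    linear_combination e1 + c * e2
  -- a non-zero row-`t` value
  obtain ⟨x₀, hx₀, hx₀t⟩ : ∃ x₀ ∈ W, ρt x₀ ≠ 0 := by
    by_contra h
    push Not at h
    apply ht0
    rw [Submodule.finrank_eq_zero, Submodule.eq_bot_iff]
    rintro _ ⟨x, hx, rfl⟩
    exact h x hx
  obtain ⟨z₀, hz₀W, hz₀s, hz₀r⟩ := St x₀ hx₀
  -- `L_s ⊥ v_t` entirely
  have horth : ∀ v ∈ W.map ρs, ∀ l l' : Fin 4, l ≠ l' →
      (ρt x₀) l * v l' + (ρt x₀) l' * v l = 0 := by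
    rintro _ ⟨x, hx, rfl⟩ l l' hll'
    obtain ⟨z, hzW, hzs, hzr⟩ := Ss x hx
    have hsum : z + z₀ ∈ W := W.add_mem hzW hz₀W
    have e := perms_vanish_of_lever_three M hM3 (z + z₀) s t
      (hlev (z + z₀) hsum
        (fun j => by rw [Pi.add_apply, hzs s' j hss'.symm, hz₀s s' j hs't, add_zero])
        (fun j => by rw [Pi.add_apply, hzs t' j hst'.symm, hz₀s t' j htt'.symm, add_zero]))
      l l' hll'
    simp only [Pi.add_apply, hzs t _ hst.symm, hz₀s s _ hst, add_zero, zero_add, hzr, hz₀r] at e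
    rw [eρt, eρt, eρs, eρs]
    linear_combination e
  have := eq_zero_of_bilinear_perm_orth (K ∙ ρt x₀) (W.map ρs)
    (fun v hv v' hv' l l' hll' => by
      rw [Submodule.mem_span_singleton] at hv
      obtain ⟨c, rfl⟩ := hv
      have e := horth v' hv' l l' hll'
      simp only [Pi.smul_apply, smul_eq_mul]
      linear_combination c * e)
    (by rw [hs2]) (ρt x₀) (Submodule.mem_span_singleton_self _)
  exact hx₀t this

set_option maxHeartbeats 800000 in
/-- **No toric `6`-dimensional singular subspace has two rows of rank `≤ 1`.**  See the module
docstring. [folklore] -/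
theorem false_of_two_rows_rank_le_one [CharZero K] (W : Submodule K (Fin 4 × Fin 4 → K))
    (hW3 : ∀ x ∈ W, ∀ (r c : Fin 3 → Fin 4), Function.Injective r → Function.Injective c →
      ((Matrix.of fun i j => x (i, j)).submatrix r c).permanent = 0)
    (hrow : ∀ r : Fin 4, finrank K (W.map (LinearMap.funLeft K K fun j : Fin 4 => (r, j))) ≤ 2)
    (hcol : ∀ l : Fin 4, finrank K (W.map (LinearMap.funLeft K K fun i : Fin 4 => (i, l))) ≤ 2)
    (h6 : finrank K W = 6) (q q' : Fin 4) (hqq' : q ≠ q')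
    (hq : finrank K (W.map (LinearMap.funLeft K K fun j : Fin 4 => (q, j))) ≤ 1)
    (hq' : finrank K (W.map (LinearMap.funLeft K K fun j : Fin 4 => (q', j))) ≤ 1) : False := by
  classical
  have eρ : ∀ (r : Fin 4) (x : Fin 4 × Fin 4 → K) (j : Fin 4),
      (LinearMap.funLeft K K fun j : Fin 4 => (r, j)) x j = x (r, j) := fun _ _ _ => rfl
  have eγ : ∀ (l : Fin 4) (x : Fin 4 × Fin 4 → K) (i : Fin 4),
      (LinearMap.funLeft K K fun i : Fin 4 => (i, l)) x i = x (i, l) := fun _ _ _ => rfl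
  -- zero rows are excluded
  have hnz : ∀ r, finrank K (W.map (LinearMap.funLeft K K fun j : Fin 4 => (r, j))) ≠ 0 := by
    intro r h0
    rw [Submodule.finrank_eq_zero] at h0
    refine false_of_zero_row W hW3 hrow hcol h6 r fun x hx j => ?_
    have : (LinearMap.funLeft K K fun j : Fin 4 => (r, j)) x ∈
        W.map (LinearMap.funLeft K K fun j : Fin 4 => (r, j)) := ⟨x, hx, rfl⟩
    rw [h0, Submodule.mem_bot] at this
    have := congr_fun this j; rwa [eρ] at this
  -- the other two rows
  obtain ⟨p, p', hpp', hpq, hpq', hp'q, hp'q', -⟩ := exists_other_two q q' hqq'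
  -- dimensions of the single-row spaces; all rows split off
  have dTp := finrank_single_le W q q' p'
  have dTp' := finrank_single_le W q q' p
  have dTq := finrank_single_le W p p' q'
  have dTq' := finrank_single_le W p p' q
  have hrp := hrow p; have hrp' := hrow p'
  obtain ⟨hTp, Sp⟩ := single_row_realize W p q q' p' hpq hpq' hpp' hqq' hp'q.symm hp'q'.symm
    (by omega)
  obtain ⟨hTp', Sp'⟩ := single_row_realize W p' q q' p hp'q hp'q' hpp'.symm hqq' hpq.symm
    hpq'.symm (by omega)
  obtain ⟨hTq, Sq⟩ := single_row_realize W q p p' q' hpq.symm hp'q.symm hqq' hpp' hpq' hp'q'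
    (by omega)
  obtain ⟨hTq', Sq'⟩ := single_row_realize W q' p p' q hpq'.symm hp'q'.symm hqq'.symm hpp' hpq hp'q
    (by omega)
  have hp2 : finrank K (W.map (LinearMap.funLeft K K fun j : Fin 4 => (p, j))) = 2 := by omega
  have hp'2 : finrank K (W.map (LinearMap.funLeft K K fun j : Fin 4 => (p', j))) = 2 := by omega
  -- the key step, twice: `v_q ∈ L_p` and `v_q ∈ L_{p'}`
  have kq_p := row_mem_of_split W hW3 hrow h6 p' p q' q hpp'.symm hp'q' hp'q hpq' hpq hqq'.symm
    hp'2 (hnz q') hq' hq Sp' Sq'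
  have kq_p' := row_mem_of_split W hW3 hrow h6 p p' q' q hpp' hpq' hpq hp'q' hp'q hqq'.symm
    hp2 (hnz q') hq' hq Sp Sq'
  -- a column in the support of `v_q` has rank 3
  obtain ⟨y₀, hy₀, j, hj⟩ : ∃ y₀ ∈ W, ∃ j, y₀ (q, j) ≠ 0 := by
    by_contra h
    push Not at h
    apply hnz q
    rw [Submodule.finrank_eq_zero, Submodule.eq_bot_iff]
    rintro _ ⟨x, hx, rfl⟩
    funext j; rw [eρ]; exact h x hx j
  have unit_mem : ∀ r : Fin 4, (∃ z ∈ W, (∀ i j', i ≠ r → z (i, j') = 0) ∧ z (r, j) ≠ 0) →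
      (Pi.single r (1 : K) : Fin 4 → K) ∈ W.map (LinearMap.funLeft K K fun i : Fin 4 => (i, j)) := by
    rintro r ⟨z, hzW, hzs, hzr⟩
    refine ⟨(z (r, j))⁻¹ • z, W.smul_mem _ hzW, funext fun i => ?_⟩
    rw [map_smul, Pi.smul_apply, eγ, smul_eq_mul]
    by_cases hir : i = r
    · rw [hir, inv_mul_cancel₀ hzr, Pi.single_eq_same]
    · rw [hzs i j hir, mul_zero, Pi.single_eq_of_ne hir]
  have eq_mem : (Pi.single q (1 : K) : Fin 4 → K) ∈
      W.map (LinearMap.funLeft K K fun i : Fin 4 => (i, j)) := by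
    obtain ⟨z, hzW, hzs, hzr⟩ := Sq y₀ hy₀
    exact unit_mem q ⟨z, hzW, hzs, by rw [hzr]; exact hj⟩
  have ep_mem : (Pi.single p (1 : K) : Fin 4 → K) ∈
      W.map (LinearMap.funLeft K K fun i : Fin 4 => (i, j)) := by
    obtain ⟨x, hx, hxq⟩ := kq_p y₀ hy₀
    obtain ⟨z, hzW, hzs, hzr⟩ := Sp x hx
    refine unit_mem p ⟨z, hzW, hzs, ?_⟩
    rw [hzr, ← eρ p x j, hxq, eρ]; exact hj
  have ep'_mem : (Pi.single p' (1 : K) : Fin 4 → K) ∈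
      W.map (LinearMap.funLeft K K fun i : Fin 4 => (i, j)) := by
    obtain ⟨x, hx, hxq⟩ := kq_p' y₀ hy₀
    obtain ⟨z, hzW, hzs, hzr⟩ := Sp' x hx
    refine unit_mem p' ⟨z, hzW, hzs, ?_⟩
    rw [hzr, ← eρ p' x j, hxq, eρ]; exact hj
  have hli : LinearIndependent K (⇑(Pi.basisFun K (Fin 4)) ∘ ![p, p', q]) :=
    (Pi.basisFun K (Fin 4)).linearIndependent.comp _ (injective_vec_three hpp' hpq hp'q)
  have hspan : Submodule.span K (Set.range (⇑(Pi.basisFun K (Fin 4)) ∘ ![p, p', q])) ≤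
      W.map (LinearMap.funLeft K K fun i : Fin 4 => (i, j)) := by
    rw [Submodule.span_le]
    rintro _ ⟨i, rfl⟩
    fin_cases i
    · simpa using ep_mem
    · simpa using ep'_mem
    · simpa using eq_mem
  have h3 : finrank K (Submodule.span K (Set.range (⇑(Pi.basisFun K (Fin 4)) ∘ ![p, p', q])))
      = 3 := by rw [finrank_span_eq_card hli, Fintype.card_fin]
  have := Submodule.finrank_mono hspan
  have := hcol j
  omega

end Summit.ValiantsHypothesis.ValiantsHypothesis.Theorems.SymPencilPerFourToricLowRank

end
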